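import Summits.BirchSwinnertonDyer.BirchSwinnertonDyer.Theorems.Rank1ResidualJetLocalKummerTransport
import Summits.BirchSwinnertonDyer.BirchSwinnertonDyer.Theorems.Rank1ResidualJetSelmerDefs
import Literature.NumberTheory.EllipticCurves.SelmerGaloisActionPlaces
import Literature.NumberTheory.EllipticCurves.GaloisConjugateReductionTypeProofs
import Literature.NumberTheory.EllipticCurves.TamagawaRingEquivProofs
import Literature.NumberTheory.EllipticCurves.LocalKummerMap
import HarnessLib

/-!
# T1 JET (cell `bsd-jet`), road K: the plumbing input `h𝒮σ` PROVED — the local action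
# `σ_* = conjActPlace` carries the stringent family `JET.stringentFamily` at `v` into the one at `σ v`

HONEST FRAMING (programme file §HONESTY, verbatim): «no tranche here proves BSD; ARM L moves the
LITERAL column of an r ≤ 1 census into the kernel-proved-modulo-named-print column.» THEOREMS ONLY
(seat `bsd-jet-pv-2`, session g4; `--supports stmt-BirchSwinnertonDyer-14418`, helper); 0 classes
move; plumbing (transport of structure). WHAT THIS IS. The H63 line
(`JET.tamagawaExponent_le_mInfty_of_localFacts`, p512962) carries the hypothesis `h𝒮σ`: for
`τ • v = w`, `σ_* = conjActPlace` maps `JET.stringentFamily … (Sum.inr v)` into `… (Sum.inr w)`. Here it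
is PROVED for every automorphism `σ ∈ Aut(K/ℚ)` and every pair of finite places `σ • v = w`
(`conjActPlace_mem_stringentFamily`): the Galois transport `θ = σ_v : K_v ≃ K_w` of completions
(`galAdicCompletionEquiv`) preserves the valuation, hence integers, minimality of the base-changed
equation (`isMinimal_map_iff_of_valuation_eq`) and — §1, for any isomorphism of discretely valued
fields and Mathlib's reduction — the set of points with nonsingular reduction `E₀`
(`isNonsingularReductionPoint_mapPoint_iff`); and `σ_*` carries the local Kummer class of a `K_v`-point
`P` to the local Kummer class of its transport `θ P` (`localConjH1_localKummerClass`, p513742, and the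
coordinate lemma `localPointsMap_baseChangeGeomPointsEquiv_toGeomPoints`). So `σ_*(δ_v(E₀(K_v))) ⊆
δ_w(E₀(K_w))` at minimal places, and `σ_*(Kum_v) ⊆ Kum_w` (pv-1) at the others.
References: [cite: SilvermanAEC2009, VII.1 Prop. 1.3 (b), VII.2 (reduction map), X.§4 (**)]
[cite: CasselsFrohlichANT1967, Ch. VII §1.1] [cite: Jetchev2008, §3.1 (p. 814), §5 Thm. 5.1].
-/

set_option autoImplicit false

noncomputable section

open scoped Classical

open WeierstrassCurve Field IsLocalRing Literature.NumberTheory.EllipticCurves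
  Literature.NumberTheory.GaloisRepresentations

namespace Summit.BirchSwinnertonDyer.Rank1Residual.JET

/-! ## §1 Transport of `E₀` (Mathlib's `IsNonsingularReductionPoint`) along an isomorphism of
discretely valued fields -/

section Transport

variable {R₁ K₁ R₂ K₂ : Type*}
  [CommRing R₁] [IsDomain R₁] [IsDiscreteValuationRing R₁] [Field K₁] [Algebra R₁ K₁]
  [IsFractionRing R₁ K₁]
  [CommRing R₂] [IsDomain R₂] [IsDiscreteValuationRing R₂] [Field K₂] [Algebra R₂ K₂]
  [IsFractionRing R₂ K₂]
  (ψ : R₁ ≃+* R₂) (φ : K₁ ≃+* K₂)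
  (hc : ∀ r : R₁, φ (algebraMap R₁ K₁ r) = algebraMap R₂ K₂ (ψ r))

include hc in
omit [IsDomain R₁] [IsDiscreteValuationRing R₁] [IsFractionRing R₁ K₁] [IsDomain R₂]
  [IsDiscreteValuationRing R₂] in
/-- Mathlib's integral model is transported: `integralModel R₂ (X.map φ) = (integralModel R₁ X).map ψ`
(coefficients are determined by their images in the fraction field). [folklore] -/
theorem integralModel_map_ringEquiv (X : WeierstrassCurve K₁) [X.IsIntegral R₁]
    [(X.map (φ : K₁ →+* K₂)).IsIntegral R₂] :
    integralModel R₂ (X.map (φ : K₁ →+* K₂)) = (integralModel R₁ X).map (ψ : R₁ →+* R₂) := by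
  have hinj := IsFractionRing.injective R₂ K₂
  ext
  · apply hinj
    rw [integralModel_a₁_eq, map_a₁, map_a₁, RingEquiv.coe_toRingHom, RingEquiv.coe_toRingHom, ← hc,
      integralModel_a₁_eq]
  · apply hinj
    rw [integralModel_a₂_eq, map_a₂, map_a₂, RingEquiv.coe_toRingHom, RingEquiv.coe_toRingHom, ← hc,
      integralModel_a₂_eq]
  · apply hinj
    rw [integralModel_a₃_eq, map_a₃, map_a₃, RingEquiv.coe_toRingHom, RingEquiv.coe_toRingHom, ← hc,
      integralModel_a₃_eq]
  · apply hinj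
    rw [integralModel_a₄_eq, map_a₄, map_a₄, RingEquiv.coe_toRingHom, RingEquiv.coe_toRingHom, ← hc,
      integralModel_a₄_eq]
  · apply hinj
    rw [integralModel_a₆_eq, map_a₆, map_a₆, RingEquiv.coe_toRingHom, RingEquiv.coe_toRingHom, ← hc,
      integralModel_a₆_eq]

include hc in
/-- **`E₀` is transported along an isomorphism of discretely valued fields** (Mathlib's predicate
`IsNonsingularReductionPoint` of `Tamagawa.lean`): for compatible `ψ : R₁ ≃+* R₂`, `φ : K₁ ≃+* K₂`,
minimal `X/K₁` and `Y = X.map φ` minimal over `R₂`, a point `P` of `X` has nonsingular reduction iff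
its image `(φ x, φ y)` on `Y` has (the reductions correspond under the residue-field isomorphism
induced by `ψ`). Silverman, *AEC* VII.2. [cite: SilvermanAEC2009, VII.2 (PDF pp. 166–167)] -/
theorem isNonsingularReductionPoint_mapPoint_iff (X : WeierstrassCurve K₁) [X.IsMinimal R₁]
    {Y : WeierstrassCurve K₂} (hY : X.map (φ : K₁ →+* K₂) = Y) [Y.IsMinimal R₂]
    (P : X.toAffine.Point) :
    Y.IsNonsingularReductionPoint R₂ (mapPoint (φ : K₁ →+* K₂) hY P) ↔
      X.IsNonsingularReductionPoint R₁ P := by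
  subst hY
  have hI := integralModel_map_ringEquiv ψ φ hc X
  have hred : (X.map (φ : K₁ →+* K₂)).reduction R₂ =
      (X.reduction R₁).map
        ((ResidueField.mapEquiv ψ : ResidueField R₁ ≃+* ResidueField R₂) :
          ResidueField R₁ →+* ResidueField R₂) := by
    rw [WeierstrassCurve.reduction, WeierstrassCurve.reduction, hI, map_residue_ringEquiv]
  have hrange : ∀ x : K₁, (φ : K₁ →+* K₂) x ∈ Set.range (algebraMap R₂ K₂) ↔
      x ∈ Set.range (algebraMap R₁ K₁) := fun x ↦ by
    rw [← RingHom.coe_range, ← RingHom.coe_range, SetLike.mem_coe, SetLike.mem_coe]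
    exact ringEquiv_mem_range_algebraMap_iff ψ φ hc x
  rcases P with _ | ⟨x, y, h⟩
  · exact iff_of_true trivial trivial
  · rw [mapPoint_some]
    simp only [IsNonsingularReductionPoint]
    refine or_congr (not_congr (hrange x)) ⟨?_, ?_⟩
    · rintro ⟨x₀, y₀, hx, hy, hns⟩
      refine ⟨ψ.symm x₀, ψ.symm y₀, ?_, ?_, ?_⟩
      · apply φ.injective
        rw [← RingEquiv.coe_toRingHom φ, ← hx, RingEquiv.coe_toRingHom, hc, RingEquiv.apply_symm_apply]
      · apply φ.injective
        rw [← RingEquiv.coe_toRingHom φ, ← hy, RingEquiv.coe_toRingHom, hc, RingEquiv.apply_symm_apply]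
      · rw [hred, ← ψ.apply_symm_apply x₀, ← ψ.apply_symm_apply y₀] at hns
        rw [← RingEquiv.coe_toRingHom ψ, ← ResidueField.map_residue, ← ResidueField.map_residue] at hns
        exact (Affine.map_nonsingular _
          (ResidueField.mapEquiv ψ : ResidueField R₁ ≃+* ResidueField R₂).injective _ _).mp hns
    · rintro ⟨x₀, y₀, hx, hy, hns⟩
      refine ⟨ψ x₀, ψ y₀, ?_, ?_, ?_⟩
      · rw [← hc, hx, RingEquiv.coe_toRingHom]
      · rw [← hc, hy, RingEquiv.coe_toRingHom]
      · rw [hred, ← RingEquiv.coe_toRingHom ψ, ← ResidueField.map_residue, ← ResidueField.map_residue]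
        exact (Affine.map_nonsingular _
          (ResidueField.mapEquiv ψ : ResidueField R₁ ≃+* ResidueField R₂).injective _ _).mpr hns

end Transport

/-! ## §2 Points: the transport of `K_v`-points and of their images in `E(K̄_v)` -/

section Points

universe u

variable {K : Type u} [Field K] [CharZero K] (W : WeierstrassCurve ℚ)
variable {E E' : Type u} [Field E] [Algebra K E] [Field E'] [Algebra K E'] [CharZero E] [CharZero E']
variable {θ : E ≃+* E'} {Θ : AlgebraicClosure E ≃+* AlgebraicClosure E'}

/-- **Coordinates**: for a lift `Θ` of `θ : E ≃+* E'` (`Θ ∘ algebraMap = algebraMap ∘ θ`) and a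
rational point `P ∈ E(E)`, the transport `Θ` of the image of `P` in `E(K̄_E)` is the image in
`E(K̄_{E'})` of the point `θ P ∈ E(E')` (both have coordinates `algebraMap (θ x), algebraMap (θ y)`).
[folklore] -/
theorem localPointsMap_baseChangeGeomPointsEquiv_toGeomPoints (hΘ : IsLiftOfRingEquiv θ Θ)
    (hX : ((W.baseChange K).baseChange E).map (θ : E →+* E') = (W.baseChange K).baseChange E')
    (P : ((W.baseChange K).baseChange E).toAffine.Point) :
    localPointsMap W Θ ((W.baseChange K).baseChangeGeomPointsEquiv E
        (toGeomPoints ((W.baseChange K).baseChange E) P)) =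
      (W.baseChange K).baseChangeGeomPointsEquiv E'
        (toGeomPoints ((W.baseChange K).baseChange E') (mapPoint (θ : E →+* E') hX P)) := by
  rcases P with _ | ⟨x, y, h⟩
  · change localPointsMap W Θ ((W.baseChange K).baseChangeGeomPointsEquiv E
        (toGeomPoints ((W.baseChange K).baseChange E) 0)) =
      (W.baseChange K).baseChangeGeomPointsEquiv E'
        (toGeomPoints ((W.baseChange K).baseChange E') (mapPoint (θ : E →+* E') hX 0))
    rw [map_zero, map_zero, map_zero, map_zero, map_zero, map_zero]
  · rw [mapPoint_some]
    change localPointsMap W Θ ((W.baseChange K).baseChangeGeomPointsEquiv E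
        (.some (algebraMap E (AlgebraicClosure E) x) (algebraMap E (AlgebraicClosure E) y) _)) =
      (W.baseChange K).baseChangeGeomPointsEquiv E'
        (.some (algebraMap E' (AlgebraicClosure E') (θ x)) (algebraMap E' (AlgebraicClosure E') (θ y)) _)
    rw [baseChangeGeomPointsEquiv_some, baseChangeGeomPointsEquiv_some, localPointsMap_some]
    exact Affine.Point.some_eq_some_of_eq (hΘ x) (hΘ y)

end Points

/-! ## §3 `σ_*` carries the stringent family at `v` into the stringent family at `σ v` -/

section Stringent

open IsDedekindDomain NumberField Literature.NumberTheory.Automorphic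
  Literature.NumberTheory.GaloisRepresentations.DiscreteGaloisModule
  Summit.BirchSwinnertonDyer.Rank1Residual.X11b.Three

variable {K : Type} [Field K] [NumberField K] (W : WeierstrassCurve ℚ) [W.IsElliptic] (σ : K ≃ₐ[ℚ] K)

omit [W.IsElliptic] in
/-- `(W⁄K)^σ = W⁄K`: the base change of a curve over `ℚ` is fixed by `Aut(K/ℚ)`. [folklore] -/
theorem map_algEquiv_baseChange_eq : (W.baseChange K).map (σ : K →+* K) = W.baseChange K := by
  rw [WeierstrassCurve.baseChange, WeierstrassCurve.map_map]
  congr 1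
  ext x
  exact σ.commutes x

/-- **`h𝒮σ` PROVED.** For `σ ∈ Aut(K/ℚ)`, finite places `σ • v = w` and a level `n ≠ 0`: the local
action `σ_* = conjActPlace W σ n h : H¹(K_v, E[n]) → H¹(K_w, E[n])` maps the stringent family at `v`
(`JET.stringentFamily`: the connected Kummer condition `δ_v(E₀(K_v))` where the base change is minimal,
the Kummer condition elsewhere) into the stringent family at `w`. Minimal case: `σ_*(δ_v P) =
δ_w(θ P)` (`localConjH1_localKummerClass` + coordinates) and `θ P ∈ E₀(K_w)` iff `P ∈ E₀(K_v)`
(§1 along the Galois transport `θ : K_v ≃ K_w`, which preserves valuations); minimality itself is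
transported (`isMinimal_map_iff_of_valuation_eq`), so the non-minimal case is the Kummer transport
`conjActPlace_mem_kummerSelmerStructure`. [cite: SilvermanAEC2009, VII.2, X.§4 (**)]
[cite: CasselsFrohlichANT1967, Ch. VII §1.1] [cite: Jetchev2008, §3.1 (p. 814)] -/
theorem conjActPlace_mem_stringentFamily {n : ℤ} (hn : n ≠ 0) {v w : HeightOneSpectrum (𝓞 K)}
    (h : σ • v = w)
    {c : galoisCohomology (((W.baseChange K).torsionGaloisModule n).toLocal (Sum.inr v : Place K)) 1}
    (hc : c ∈ stringentFamily W K hn (Sum.inr v)) :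
    conjActPlace W σ n h c ∈ stringentFamily W K hn (Sum.inr w) := by
  subst h
  haveI : CharZero (v.adicCompletion K) := charZero_of_injective_algebraMap (algebraMap K _).injective
  haveI : CharZero ((σ • v).adicCompletion K) :=
    charZero_of_injective_algebraMap (algebraMap K _).injective
  -- the Galois transport of completions and of their integers
  set θ : v.adicCompletion K ≃+* (σ • v).adicCompletion K := galAdicCompletionEquiv (L := K) σ rfl
    with hθdef
  have hθO : ∀ y, θ y ∈ (σ • v).adicCompletionIntegers K ↔ y ∈ v.adicCompletionIntegers K := fun y ↦
    galAdicCompletionMap_mem_adicCompletionIntegers_iff K σ rfl y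
  let ψ : v.adicCompletionIntegers K ≃+* (σ • v).adicCompletionIntegers K :=
    { toFun := fun x ↦ ⟨θ x, (hθO x).mpr x.2⟩
      invFun := fun y ↦ ⟨θ.symm y, (hθO (θ.symm y)).mp (by rw [θ.apply_symm_apply]; exact y.2)⟩
      left_inv := fun x ↦ Subtype.ext (θ.symm_apply_apply _)
      right_inv := fun y ↦ Subtype.ext (θ.apply_symm_apply _)
      map_mul' := fun x y ↦ Subtype.ext (map_mul θ _ _)
      map_add' := fun x y ↦ Subtype.ext (map_add θ _ _) }
  have hcψ : ∀ r, θ (algebraMap (v.adicCompletionIntegers K) (v.adicCompletion K) r) =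
      algebraMap ((σ • v).adicCompletionIntegers K) ((σ • v).adicCompletion K) (ψ r) := fun _ ↦ rfl
  -- the base change at `σ v` is the transport of the base change at `v`
  have hX : ((W.baseChange K).baseChange (v.adicCompletion K)).map
        (θ : v.adicCompletion K →+* (σ • v).adicCompletion K) =
      (W.baseChange K).baseChange ((σ • v).adicCompletion K) := by
    have := baseChange_map_algEquiv_eq_map_galAdicCompletionEquiv σ v (W.baseChange K)
    rw [map_algEquiv_baseChange_eq] at this
    exact this.symm
  -- minimality is transported
  have hV₁ := valued_le_one_iff_mem_range_adicCompletionIntegers (K := K) v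
  have hV₂ := valued_le_one_iff_mem_range_adicCompletionIntegers (K := K) (σ • v)
  have he : ∀ y, Valued.v (θ y) = Valued.v y := fun y ↦ valued_galAdicCompletionMap K σ rfl y
  have hmin_iff : ((W.baseChange K).baseChange ((σ • v).adicCompletion K)).IsMinimal
        ((σ • v).adicCompletionIntegers K) ↔
      ((W.baseChange K).baseChange (v.adicCompletion K)).IsMinimal (v.adicCompletionIntegers K) := by
    rw [← hX]
    exact isMinimal_map_iff_of_valuation_eq hV₁ hV₂ θ he _
  by_cases hmin : ((W.baseChange K).baseChange (v.adicCompletion K)).IsMinimal (v.adicCompletionIntegers K)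
  · -- minimal at `v`, hence at `σ v`: transport of `δ_v(E₀)`
    haveI := hmin
    haveI hmin' := hmin_iff.mpr hmin
    rw [stringentFamily_inr_of_isMinimal W K hn v] at hc
    rw [stringentFamily_inr_of_isMinimal W K hn (σ • v)]
    obtain ⟨P, hP, rfl⟩ := (JetchevKummer.mem_connectedKummerCondition_iff (W.baseChange K)
      (v.adicCompletion K) (v.adicCompletionIntegers K) hn _).mp hc
    -- the transported point and its membership in `E₀(K_{σv})`
    set P' := mapPoint (θ : v.adicCompletion K →+* (σ • v).adicCompletion K) hX P with hP'def
    have hP' : P' ∈ ((W.baseChange K).baseChange ((σ • v).adicCompletion K)).goodReductionSubgroup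
        ((σ • v).adicCompletionIntegers K) := by
      rw [mem_goodReductionSubgroup_iff_holds] at hP ⊢
      exact (isNonsingularReductionPoint_mapPoint_iff ψ θ hcψ _ hX P).mpr hP
    -- `σ_*(δ_v P) = δ_{σv}(P')`
    have hΘ := isLiftOfRingEquiv_ringEquivLift (galAdicCompletionEquiv (L := K) σ (rfl : σ • v = σ • v))
    have key : conjActPlace W σ n rfl ((W.baseChange K).localKummerMap (v.adicCompletion K) hn P) =
        (W.baseChange K).localKummerMap ((σ • v).adicCompletion K) hn P' := by
      change localConjH1 W (isLiftOfAut_liftAutPlace σ rfl) hΘ (liftsCommute_liftAutPlace σ rfl) n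
        ((W.baseChange K).localKummerClass n hn
          ((W.baseChange K).localZSMulRoot (v.adicCompletion K) hn P) _) = _
      rw [localConjH1_localKummerClass]
      symm
      refine (W.baseChange K).localKummerMap_eq_localKummerClass ((σ • v).adicCompletion K) hn P' _ _ ?_
      rw [← map_zsmul, (W.baseChange K).zsmul_localZSMulRoot (v.adicCompletion K) hn P, hP'def]
      exact localPointsMap_baseChangeGeomPointsEquiv_toGeomPoints W hΘ hX P
    rw [key]
    exact JetchevKummer.localKummerMap_mem_connectedKummerCondition (W.baseChange K)
      ((σ • v).adicCompletion K) ((σ • v).adicCompletionIntegers K) hn hP'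
  · -- not minimal at `v`, hence not at `σ v`: the Kummer transport
    have hmin' : ¬ ((W.baseChange K).baseChange ((σ • v).adicCompletion K)).IsMinimal
        ((σ • v).adicCompletionIntegers K) := fun h' ↦ hmin (hmin_iff.mp h')
    simp only [stringentFamily, dif_neg hmin] at hc
    simp only [stringentFamily, dif_neg hmin']
    exact conjActPlace_mem_kummerSelmerStructure W σ n rfl hc

end Stringent

end Summit.BirchSwinnertonDyer.Rank1Residual.JET

end
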